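import Mathlib

/-!
# Cable-slope arithmetic for the (Q-sym″) structure theorem (solo notes, structureII §11.7)

In the toroidal case of the structure theorem for untwisting circles of `T(2,7)` with linking
number `4`, Gabai's solid-torus surgery theorem leaves a `(w,q)`-cable (`w ≥ 2` strands, `q ≠ 0`)
of an unknotted core, and the cable space fills to a solid torus along the twist slope `1/s`
only if `Δ(1/s, wq) = |1 - w·q·s| = 1`.  With the twist parameter `s ∈ {±1, ±2}` this forces
`w = 2`, `q = s`, `|s| = 1` (the axis-cable configuration, four full twists on the core), and at the
next level of the recursion (slope `1/(4ε)`) it is impossible.  These two elementary facts are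
recorded here so that the arithmetic of §11.7 is kernel-checked.
-/

namespace Summit.SmoothPoincare4.SmoothPoincare4.Theorems

/-- For integers `w ≥ 2` and `q ≠ 0`, the product satisfies `w q ≥ 2` or `w q ≤ -2`. -/
private lemma soloInformed_two_le_mul_or (w q : ℤ) (hw : 2 ≤ w) (hq : q ≠ 0) :
    2 ≤ w * q ∨ w * q ≤ -2 := by
  rcases lt_or_gt_of_ne hq with hneg | hpos
  · right
    have hq1 : (0 : ℤ) ≤ -1 - q := by omega
    nlinarith [mul_nonneg (sub_nonneg.mpr hw) hq1]
  · left
    have hq1 : (1 : ℤ) ≤ q := by omega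
    nlinarith [mul_nonneg (sub_nonneg.mpr hw) (sub_nonneg.mpr hq1)]

/-- `w q = 2` with `w ≥ 2`, `q ≠ 0` forces `w = 2`, `q = 1`. -/
private lemma soloInformed_mul_eq_two (w q : ℤ) (hw : 2 ≤ w) (hq : q ≠ 0) (h2 : w * q = 2) :
    w = 2 ∧ q = 1 := by
  rcases lt_or_gt_of_ne hq with hneg | hpos
  · exfalso
    have hq1 : (0 : ℤ) ≤ -1 - q := by omega
    nlinarith [mul_nonneg (sub_nonneg.mpr hw) hq1]
  · have hq1 : (1 : ℤ) ≤ q := by omega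
    rcases eq_or_lt_of_le hq1 with hq1' | hq2
    · subst hq1'
      exact ⟨by linarith, rfl⟩
    · exfalso
      have hq2' : (2 : ℤ) ≤ q := by omega
      nlinarith [mul_nonneg (sub_nonneg.mpr hw) (sub_nonneg.mpr hq2')]

/-- `w q = -2` with `w ≥ 2`, `q ≠ 0` forces `w = 2`, `q = -1`. -/
private lemma soloInformed_mul_eq_neg_two (w q : ℤ) (hw : 2 ≤ w) (hq : q ≠ 0)
    (h2 : w * q = -2) : w = 2 ∧ q = -1 := by
  rcases lt_or_gt_of_ne hq with hneg | hpos
  · have hq1 : q ≤ -1 := by omega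
    rcases eq_or_lt_of_le hq1 with hq1' | hq2
    · subst hq1'
      exact ⟨by linarith, rfl⟩
    · exfalso
      have hq2' : (0 : ℤ) ≤ -2 - q := by omega
      nlinarith [mul_nonneg (sub_nonneg.mpr hw) hq2']
  · exfalso
    have hq1 : (1 : ℤ) ≤ q := by omega
    nlinarith [mul_nonneg (sub_nonneg.mpr hw) (sub_nonneg.mpr hq1)]

/-- First level: a `(w,q)`-cable (`w ≥ 2`, `q ≠ 0`) whose cable space fills to a solid torus along the
twist slope `1/s`, `s ∈ {±1, ±2}`, i.e. `|1 - w q s| = 1`, is the `(2,s)`-cable with `|s| = 1`. -/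
theorem SoloInformed_cable_slope_arith (w q s : ℤ) (hw : 2 ≤ w) (hq : q ≠ 0)
    (hs : s = 1 ∨ s = -1 ∨ s = 2 ∨ s = -2)
    (h : 1 - w * q * s = 1 ∨ 1 - w * q * s = -1) :
    w = 2 ∧ q = s ∧ (s = 1 ∨ s = -1) := by
  have hbig := soloInformed_two_le_mul_or w q hw hq
  rcases hs with rfl | rfl | rfl | rfl
  · have h2 : w * q = 2 := by
      rcases h with h | h <;> rcases hbig with hb | hb <;> linarith
    obtain ⟨hw2, hq1⟩ := soloInformed_mul_eq_two w q hw hq h2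
    exact ⟨hw2, hq1, Or.inl rfl⟩
  · have h2 : w * q = -2 := by
      rcases h with h | h <;> rcases hbig with hb | hb <;> linarith
    obtain ⟨hw2, hq1⟩ := soloInformed_mul_eq_neg_two w q hw hq h2
    exact ⟨hw2, hq1, Or.inr rfl⟩
  · exfalso
    rcases h with h | h <;> rcases hbig with hb | hb <;> linarith
  · exfalso
    rcases h with h | h <;> rcases hbig with hb | hb <;> linarith

/-- Second level of the recursion: along the induced slope `1/(4ε)` on the lk-2 core no cable
(`w ≥ 2`, `q ≠ 0`) has a solid-torus filling: `|1 - w q (4ε)| = 1` is impossible. -/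
theorem SoloInformed_cable_slope_arith_level2 (w q e : ℤ) (hw : 2 ≤ w) (hq : q ≠ 0)
    (he : e = 1 ∨ e = -1)
    (h : 1 - w * q * (4 * e) = 1 ∨ 1 - w * q * (4 * e) = -1) : False := by
  have hbig := soloInformed_two_le_mul_or w q hw hq
  rcases he with rfl | rfl <;> rcases h with h | h <;> rcases hbig with hb | hb <;> linarith

/-- The instance realised by every census hit: `w = 2`, `q = s = -1` (mirror: `q = s = 1`). -/
example : (1 : ℤ) - 2 * (-1) * (-1) = -1 := by norm_num

end Summit.SmoothPoincare4.SmoothPoincare4.Theorems
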